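import Summits.BirchSwinnertonDyer.Rank1Residual.PrintX8.CertificateSchema
import Literature.NumberTheory.EllipticCurves.Rank1Residual.Typed.X8
import Literature.NumberTheory.EllipticCurves.Kato2004.ThreeAdicFrobeniusCertificate
import Literature.NumberTheory.EllipticCurves.Wuthrich2014.ThreeAdicImageSupersingularProofs
import HarnessLib

/-!
# Leaf X8, print-tier cell `bsd-print-x8` — what a certificate record CLAIMS about its curve, and the per-class hypotheses the provers' discharges consume

HONEST FRAMING (cell `bsd-print-x8`, run/shared/lean/pub/bsd-print-x8/, D-0131 (2) PRINT TIER, typer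
seat ty3): the leaf `Rank1Residual.ClassX8 W p := p = 3 ∧ GoodSS W 3 ∧ a_3 ≠ 0` counts only when its
CLASS THEOREM is in the kernel BY NAME, flag-free (PARTITION currency). This file books nothing, is
not a class theorem, introduces NO named fact and asserts nothing about any curve: `Record.Claim` is
a `Prop` to be taken as an explicit hypothesis `(h : r.Claim)` (D-0014 style, exactly as
`Literature/…/X11RankOneCertificates/Claim.lean` and `KuriharaCertificates/Claim.lean`), and every
theorem below is bookkeeping from that hypothesis plus PROVED tree theorems.

Companion of `CertificateSchema.lean` (the record FORMAT and its in-kernel recheck) and of the data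
files `CertificateRecords*.lean` (217 census cells of ladder row K3/A8). `Record.Claim r` says, in the
tree's vocabulary, what the record MEANS for its curve `r.curve` (Cremona's reduced minimal model,
instance hypotheses `[r.curve.IsElliptic] [r.curve.IsGloballyMinimal]`): the leaf `ClassX8 r.curve 3`
with `a₃ = r.a3`; the analytic rank, `#E(ℚ)_tors`, `∏ c_q` and the analytic order of `Ш`
(`shaAn r.curve = r.shaAn`, Miller's `#Ш_an`, two engines); `Semistable ↔ sst`; `Surj W 3 ↔ surj3`
(the kernel-certified mod-`3` image bit: `S₄` witnesses / resolvent root, schema docstring); and the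
`3`-adic Frobenius witness (`frob9`: good `ℓ ≡ 2, 5 (mod 9)` with `a_ℓ ≡ 3, 6 (mod 9)`).

What the provers' discharges get from `(h : r.Claim)` (all PROVED here, no fact):
* `classX8_of_claim`, `irr_of_claim` (`E[3]` irreducible: Serre 1972 Prop. 12, tree theorem
  `ClassX8.irr`), `surj_of_claim` / `not_surj_of_claim` (the image bit), `surj_of_claim_of_sst`
  (semistable ⇒ onto, `ClassX8.surj_of_semistable`, independent of the bit);
* `forall_surj_pow_of_claim` — `ρ̄_{E,3ⁿ}` onto for every `n` from surj(3) ALONE, by Wuthrich 2014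
  Lemma 20 at the good prime `3` (PROVED: `Wuthrich2014.lemma20_surjective_threeAdic_of_semistable_holds`),
  hence Kato's (12.5.2) `Kato2004.ImageContainsSL2 r.curve 3` (`imageContainsSL2_of_claim`); and the
  same from the Frobenius witness (`forall_surj_pow_of_claim_of_frob9`, tree theorem
  `forall_hasSurjectiveModNGaloisRep_three_pow_of_frobenius`) — two independent kernel roads;
* `missingPPartAt_iff_of_claim`, `missingLowerBoundAt_iff_of_claim`, `missingUpperBoundAt_iff_of_claim`:
  with `#Ш_an = r.shaAn` an INTEGER, the cell's typed outputs at `(E, 3)` (`Typed/Basic.lean`) read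
  `ord₃ #Ш(E) = / ≥ / ≤ ord₃ r.shaAn`; and `bsdp_iff_of_claim`: granted GZK, Miller's `BSD(E,3)` for the
  record's curve IS the equality `ord₃ #Ш(E/ℚ) = ord₃ r.shaAn` (`= r.ord3Sha`, a kernel-checked field).
So on a certified record the per-cell residual is ONE integer equality about `#Ш(E)[3^∞]`, and every
per-class hypothesis of the cited theorems of the cell (CCSS 2018 Thms. C/D: semistable, `Irr`;
Sprung 2024 Cors. 1.2/1.3: square-free `N`; Kato/Perrin-Riou/Wuthrich: (12.5.2) or surj(3); the
rank; the unit-cell test `ord3Quot = 0`) is a field of the record read through this file.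

References: Serre 1972 §1.11 Prop. 12, §5.4 Prop. 21 [Serre1972]; Wuthrich 2014 Lemma 20, Prop. 21
[Wuthrich2014]; Kato 2004 (12.5.2) [Kato2004Asterisque]; Elkies 2006 [Elkies2006]; Miller 2011
Def. 1.1 [Miller2011LMS]; Zywina 2015 Thm. 1.2 [Zywina2015]; Cremona's tables [Cremona2006].
-/

noncomputable section

open scoped Classical

open WeierstrassCurve Literature.NumberTheory.EllipticCurves
  Literature.NumberTheory.EllipticCurves.Rank1Residual
  Literature.NumberTheory.EllipticCurves.Rank1Residual.Typed

namespace Summit.BirchSwinnertonDyer.Rank1Residual.PrintX8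

namespace Record

/-- The Weierstrass equation over `ℚ` with the record's a-invariants (junk: the zero equation when
`ainvs` does not have five entries — excluded by `Record.check`). For the cell's records this is
Cremona's reduced global minimal model of the curve `label`. [folklore] -/
def curve (r : Record) : WeierstrassCurve ℚ :=
  match r.ainvs with
  | [a₁, a₂, a₃, a₄, a₆] => ⟨a₁, a₂, a₃, a₄, a₆⟩
  | _ => ⟨0, 0, 0, 0, 0⟩

/-- **What a record claims about its curve** (an explicit hypothesis; the engines' computation and
the kernel-rechecked certificates, in the tree's vocabulary): the leaf `ClassX8 r.curve 3` with
`a₃ = r.a3`; `r_an = r.rank`, `#E(ℚ)_tors = r.torsion`, `∏ c_q = r.tamagawa`, Miller's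
`#Ш_an = r.shaAn`; `Semistable ↔ r.sst`; `ρ̄_{E,3}` onto `↔ r.surj3`; and for the recorded Frobenius
witness `(ℓ, a)`: good reduction at `ℓ` with `a_ℓ = a`. [folklore] -/
def Claim (r : Record) [r.curve.IsElliptic] [r.curve.IsGloballyMinimal] : Prop :=
  ClassX8 r.curve 3 ∧ r.curve.frobeniusTrace 3 = r.a3 ∧
  r.curve.analyticRank = r.rank ∧ r.curve.torsionOrder = r.torsion ∧
  r.curve.tamagawaProduct = r.tamagawa ∧ _root_.Literature.NumberTheory.EllipticCurves.shaAn r.curve = (r.shaAn : ℂ) ∧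
  (Semistable r.curve ↔ r.sst = true) ∧ (Surj r.curve 3 ↔ r.surj3 = true) ∧
  (∀ t ∈ r.frob9, ∀ [Fact t.1.Prime], Good r.curve t.1 ∧ r.curve.frobeniusTrace t.1 = t.2)

variable (r : Record) [r.curve.IsElliptic] [r.curve.IsGloballyMinimal]

/-- The leaf: `ClassX8 r.curve 3`. [folklore] -/
theorem classX8_of_claim (h : r.Claim) : ClassX8 r.curve 3 := h.1

/-- Good supersingular reduction at `3`, and `a₃ = r.a3 (= ±3)`. [folklore] -/
theorem goodSS_of_claim (h : r.Claim) : GoodSS r.curve 3 ∧ r.curve.frobeniusTrace 3 = r.a3 :=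
  ⟨h.1.2.1, h.2.1⟩

/-- Analytic rank, torsion, Tamagawa product and `#Ш_an` are the record's. [folklore] -/
theorem invariants_of_claim (h : r.Claim) :
    r.curve.analyticRank = r.rank ∧ r.curve.torsionOrder = r.torsion ∧
      r.curve.tamagawaProduct = r.tamagawa ∧ _root_.Literature.NumberTheory.EllipticCurves.shaAn r.curve = (r.shaAn : ℂ) :=
  ⟨h.2.2.1, h.2.2.2.1, h.2.2.2.2.1, h.2.2.2.2.2.1⟩

/-- `E[3]` is irreducible at every X8 pair — Serre 1972 §1.11 Prop. 12 at the odd supersingular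
prime `3`, tree theorem `ClassX8.irr`. [cite: Serre1972, §1.11 Prop. 12] -/
theorem irr_of_claim (h : r.Claim) : Irr r.curve 3 := ClassX8.irr r.curve 3 h.1

/-- Semistability is the record's bit `sst`. [folklore] -/
theorem semistable_iff_of_claim (h : r.Claim) : Semistable r.curve ↔ r.sst = true := h.2.2.2.2.2.2.1

/-- The mod-`3` image bit: `surj3 = true` ⇒ `ρ̄_{E,3}` onto. [cite: Zywina2015, Thm. 1.2 (ℓ = 3)] -/
theorem surj_of_claim (h : r.Claim) (hs : r.surj3 = true) : Surj r.curve 3 := h.2.2.2.2.2.2.2.1.mpr hs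

/-- The mod-`3` image bit: `surj3 = false` ⇒ `ρ̄_{E,3}` NOT onto (image in the normaliser of a
Cartan or a Borel; on the leaf necessarily `3Nn`/`3Ns`, `E[3]` being irreducible). [cite: Zywina2015, Thm. 1.2 (ℓ = 3)] -/
theorem not_surj_of_claim (h : r.Claim) (hs : r.surj3 = false) : ¬ Surj r.curve 3 := by
  intro hS
  have h1 := h.2.2.2.2.2.2.2.1.mp hS
  rw [hs] at h1
  exact Bool.false_ne_true h1

/-- Semistable X8 curves have `ρ̄_{E,3}` onto regardless of the bit — Serre 1972 §5.4 Prop. 21 i),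
tree theorem `ClassX8.surj_of_semistable`. [cite: Serre1972, §5.4 Prop. 21 i)] -/
theorem surj_of_claim_of_sst (h : r.Claim) (hs : r.sst = true) : Surj r.curve 3 :=
  ClassX8.surj_of_semistable r.curve 3 h.1 (h.2.2.2.2.2.2.1.mpr hs)

/-- **`3`-adic tower surjectivity from surj(3) alone**: at the GOOD prime `3`, `ρ̄_{E,3}` onto ⇒
`ρ̄_{E,3ⁿ}` onto for every `n` — Wuthrich, Doc. Math. 19 (2014) Lemma 20, PROVED in the tree
(`Wuthrich2014.lemma20_surjective_threeAdic_of_semistable_holds`). [cite: Wuthrich2014, Lemma 20 (p. 399)] -/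
theorem forall_surj_pow_of_claim (h : r.Claim) (hs : r.surj3 = true) (n : ℕ) :
    r.curve.HasSurjectiveModNGaloisRep (3 ^ n : ℕ) :=
  Wuthrich2014.lemma20_surjective_threeAdic_of_semistable_holds r.curve (Or.inl h.1.2.1.1)
    (r.surj_of_claim h hs) n

/-- Hence Kato's image hypothesis (12.5.2) for `T₃E` (`Kato2004.ImageContainsSL2`), by the tree's
`imageContainsSL2_of_forall_hasSurjectiveModNGaloisRep`. [cite: Kato2004Asterisque, Thm. 12.5 (4), (12.5.2) (p. 222)] -/
theorem imageContainsSL2_of_claim (h : r.Claim) (hs : r.surj3 = true) :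
    Kato2004.ImageContainsSL2 r.curve 3 :=
  Kato2004.imageContainsSL2_of_forall_hasSurjectiveModNGaloisRep r.curve 3
    (r.forall_surj_pow_of_claim h hs)

/-- **The same tower surjectivity from the Frobenius witness** (independent of Lemma 20): a recorded
`(ℓ, a_ℓ)` with `ℓ ≡ 2, 5 (mod 9)` good and `a_ℓ ≡ 3, 6 (mod 9)` — the congruences are what
`Record.checkFrob9` verified — gives every `ρ̄_{E,3ⁿ}` onto by the tree theorem
`forall_hasSurjectiveModNGaloisRep_three_pow_of_frobenius`. [cite: Elkies2006, Introduction] -/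
theorem forall_surj_pow_of_claim_of_frob9 (h : r.Claim) (hs : r.surj3 = true) {ℓ : ℕ} {a : ℤ}
    [Fact ℓ.Prime] (hmem : (ℓ, a) ∈ r.frob9) (hℓ9 : ℓ % 9 = 2 ∨ ℓ % 9 = 5)
    (ha9 : a % 9 = 3 ∨ a % 9 = 6) (n : ℕ) : r.curve.HasSurjectiveModNGaloisRep (3 ^ n : ℕ) := by
  obtain ⟨hgood, htr⟩ := h.2.2.2.2.2.2.2.2 (ℓ, a) hmem
  exact forall_hasSurjectiveModNGaloisRep_three_pow_of_frobenius r.curve (r.surj_of_claim h hs) ℓ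
    hgood hℓ9 (by rw [htr]; exact ha9) n

/-! ### The per-cell residual in Miller's currency: one integer equality -/

/-- With `#Ш_an = r.shaAn` (an integer), the typed missing OUTPUT at `(E, 3)` (`Typed.MissingPPartAt`:
"`#Ш_an` is a rational `q` with `ord₃ q = ord₃ #Ш(E)`") reads `ord₃ #Ш(E/ℚ) = ord₃ r.shaAn`.
[cite: Miller2011LMS, Def. 1.1 (arXiv:1010.2431 p. 3)] -/
theorem missingPPartAt_iff_of_claim (h : r.Claim) :
    MissingPPartAt r.curve 3 ↔ padicValNat 3 r.curve.shaOrder = padicValNat 3 r.shaAn := by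
  have hsha := h.2.2.2.2.2.1
  constructor
  · rintro ⟨q, hq, hv⟩
    have hqn : q = (r.shaAn : ℚ) := by
      have : ((q : ℚ) : ℂ) = ((r.shaAn : ℚ) : ℂ) := by rw [← hq, hsha]; norm_cast
      exact_mod_cast this
    rw [hqn, padicValRat.of_nat] at hv
    exact_mod_cast hv.symm
  · intro hv
    exact ⟨r.shaAn, by rw [hsha]; norm_cast, by rw [padicValRat.of_nat]; exact_mod_cast hv.symm⟩

/-- The lower half (`Typed.MissingLowerBoundAt`, the main-conjecture direction) reads
`ord₃ r.shaAn ≤ ord₃ #Ш(E/ℚ)`. [cite: Miller2011LMS, Def. 1.1 (arXiv:1010.2431 p. 3)] -/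
theorem missingLowerBoundAt_iff_of_claim (h : r.Claim) :
    MissingLowerBoundAt r.curve 3 ↔ padicValNat 3 r.shaAn ≤ padicValNat 3 r.curve.shaOrder := by
  have hsha := h.2.2.2.2.2.1
  constructor
  · rintro ⟨q, hq, hv⟩
    have hqn : q = (r.shaAn : ℚ) := by
      have : ((q : ℚ) : ℂ) = ((r.shaAn : ℚ) : ℂ) := by rw [← hq, hsha]; norm_cast
      exact_mod_cast this
    rw [hqn, padicValRat.of_nat] at hv
    exact_mod_cast hv
  · intro hv
    exact ⟨r.shaAn, by rw [hsha]; norm_cast, by rw [padicValRat.of_nat]; exact_mod_cast hv⟩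

/-- The upper half (`Typed.MissingUpperBoundAt`, the Euler-system direction) reads
`ord₃ #Ш(E/ℚ) ≤ ord₃ r.shaAn`. [cite: Miller2011LMS, Def. 1.1 (arXiv:1010.2431 p. 3)] -/
theorem missingUpperBoundAt_iff_of_claim (h : r.Claim) :
    MissingUpperBoundAt r.curve 3 ↔ padicValNat 3 r.curve.shaOrder ≤ padicValNat 3 r.shaAn := by
  have hsha := h.2.2.2.2.2.1
  constructor
  · rintro ⟨q, hq, hv⟩
    have hqn : q = (r.shaAn : ℚ) := by
      have : ((q : ℚ) : ℂ) = ((r.shaAn : ℚ) : ℂ) := by rw [← hq, hsha]; norm_cast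
      exact_mod_cast this
    rw [hqn, padicValRat.of_nat] at hv
    exact_mod_cast hv
  · intro hv
    exact ⟨r.shaAn, by rw [hsha]; norm_cast, by rw [padicValRat.of_nat]; exact_mod_cast hv⟩

/-- **`BSD(E,3)` for a record's curve is ONE integer equality.** Granted Gross–Zagier–Kolyvagin
(`hGZK`: rank `=` analytic rank and `Ш` finite in analytic rank `≤ 1`) and the claim (analytic
rank `r.rank ≤ 1`, `#Ш_an = r.shaAn`), Miller's `BSD(E,3)` holds iff `ord₃ #Ш(E/ℚ) = ord₃ r.shaAn`
(the record's kernel-checked field `ord3Sha`). [cite: Miller2011LMS, §1 and Def. 1.1] -/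
theorem bsdp_iff_of_claim (hGZK : rank_eq_analyticRank_of_analyticRank_le_one) (h : r.Claim)
    (hr : r.rank ≤ 1) : BSDp r.curve 3 ↔ padicValNat 3 r.curve.shaOrder = padicValNat 3 r.shaAn := by
  have hr' : r.curve.analyticRank ≤ 1 := by rw [h.2.2.1]; exact hr
  haveI : Finite r.curve.sha := (hGZK r.curve hr').2
  rw [← r.missingPPartAt_iff_of_claim h]
  exact ⟨missingPPartAt_of_bsdp r.curve 3, bsdp_of_missingPPartAt r.curve 3 hGZK hr'⟩

/-- In particular a record's curve with `ord₃ r.shaAn = 0` (e.g. `#Ш_an = 1`: 101 of the 217 cells)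
satisfies `BSD(E,3)` iff `3 ∤ #Ш(E/ℚ)`, i.e. iff the UPPER bound `ord₃ #Ш(E) ≤ 0` holds — the
Euler-system half alone. [cite: Miller2011LMS, §1 and Def. 1.1] -/
theorem bsdp_iff_upper_of_claim_of_shaAn_unit (hGZK : rank_eq_analyticRank_of_analyticRank_le_one)
    (h : r.Claim) (hr : r.rank ≤ 1) (h0 : padicValNat 3 r.shaAn = 0) :
    BSDp r.curve 3 ↔ padicValNat 3 r.curve.shaOrder = 0 := by
  rw [r.bsdp_iff_of_claim hGZK h hr, h0]

end Record

end Summit.BirchSwinnertonDyer.Rank1Residual.PrintX8
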